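import Literature.NumberTheory.ComplexMultiplication.ReflexTypeNormInclusion
import Literature.NumberTheory.NumberFields.SplitPrimesBaseChange
import Literature.NumberTheory.NumberFields.DecompositionFieldExtremal
import Mathlib.NumberTheory.RamificationInertia.Galois
import HarnessLib

/-!
# A primitive type forces the reflex type norm of a totally split prime to generate the field
# (Shimura 1998, §8.2 Prop. 26 with §13.1 (7); the «`ℚ(π) = K`» step of Shimura–Taniyama for primitive types)

Topic `Literature/NumberTheory/ComplexMultiplication`, namespace `Literature.NumberTheory.ComplexMultiplication`.
THEOREMS ONLY (no definition, no named fact, no instance; net Literature debt 0).  Cell `hodgecm-mathlib`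
(D-0151), T5 ledger (N2): the scalar Frobenius of a CM structure of PRIMITIVE type generates the CM field.

## Setting (= that of the predicate `IsReflexTypeNorm`, `ShimuraTaniyamaHecke.lean`)

Number fields `K`, `k`, `L` with `L/ℚ` Galois, a type `Φ ⊆ Hom(K, L)`, a base embedding `j : K → L`, an
embedding `σL : k → L` whose image contains the reflex field (`Stab(σL) ≤ Stab(Φ)` in `Aut(L)`: «`k ⊇ K*`»), a
rational prime `p` SPLITTING COMPLETELY in `L` (`GaloisRepresentations.SplitsCompletely L p`), a prime `v` of `k`
above `p`, and `π ∈ 𝔬_K` whose ideal is the reflex type norm of `v` read from `j`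
(`IsReflexTypeNorm Φ j σL v (π)`: `j(π)𝔬_L = ∏_{σ ∈ Ψ_j} v^σ𝔬_L`, Shimura's `π𝔬_K = g(N_{k/K*} v)`,
§13.1 (1), (7), Thm. 1 of §13).  `Aut(L) = L ≃+* L` acts on embeddings by composition (scoped
`ringEquivCompAction`), `Gal(L/ℚ) = L ≃ₐ[ℚ] L` on the ideals of `𝔬_L` (Mathlib, pointwise).

## What is here (all proved)

* §1 dictionary `Gal(L/ℚ)`/`Aut(L)` on ideals (private plumbing + `map_mapRingHom_algEquiv_smul`).
* §2 the primes of `L` above `v` are ONE `Gal(L/σL(k))`-orbit (`exists_algEquiv_smul_eq_of_map_le`, Mathlib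
  transitivity `Ideal.exists_smul_eq_of_isGaloisGroup` over the intermediate field `σL(k)`), and above a completely
  split `p` they are permuted FREELY (`algEquiv_eq_one_of_smul_eq_of_splitsCompletely`, the tree's
  `stabilizer_eq_bot_of_splitsCompletely`); hence «`g𝔓 ∣ v` for `𝔓 ∣ v` forces `g ∈ Gal(L/σL(k))`»
  (`smul_ringHom_eq_of_map_le_smul`).
* §3 **«the set `S*` is read off the prime factorisation of `g(𝔭)`»** ([Shi98] §13.1 (7):
  `∏_{τ ∈ S*} 𝔓₁^τ ∼ ∏_α N_{k/K*}(𝔓)^{ψ_α}`): for `𝔓 ∣ v` in `L` and `g ∈ Gal(L/ℚ)`,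
  `j(π)𝔬_L ⊆ g𝔓 ↔ g ∈ S*_j = reflexLift Φ j` (`map_span_le_smul_iff_mem_reflexLift`).
* §4 **THE THEOREM** `adjoin_eq_top_of_isReflexTypeNorm_of_isPrimitive_of_splitsCompletely`: if moreover
  `(Φ, j)` is PRIMITIVE (`IsPrimitive (L ≃+* L) Φ j`, Shimura Prop. 26 / Streng Def. 3.2), then `ℚ(π) = K`.
  Proof: an automorphism `u` of `L` fixing `j(π)` fixes the ideal `j(π)𝔬_L`, hence (by §3) satisfies
  `u S*_j = S*_j`, i.e. lies in the stabiliser of `S*_j`, which for a primitive type is `Gal(L/j(K))`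
  (`isPrimitive_iff`); so `Gal(L/ℚ(j π)) ≤ Gal(L/j K)` and `j(K) ⊆ ℚ(j π)` by the Galois correspondence.
  For `[K : ℚ] = 2` (every CM type primitive, `S*_j` a single coset) this is the norm argument
  «`N(π) = p` prime ⇒ `π ∉ ℚ`» of the tree's `exists_tateRep_eq_tateModuleMap_and_adjoin_eq_top`.

## References

* [Shimura1998] G. Shimura, *Abelian Varieties with Complex Multiplication and Modular Functions*, Princeton
  1998: §8.2 Prop. 26 (p. 61: «`(F; {φᵢ})` is primitive if and only if `H₁ = H'`»); §8.3 Prop. 28–29;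
  §13.1 (1), (7) and Thm. 1 (pp. 96–98: `π𝔬_K = g(N_{k/K*}𝔭)`, the primes `𝔓₁^τ`, `τ ∈ S*`).
* [NeukirchANT1999] J. Neukirch, *Algebraic Number Theory*, Ch. I §9 Prop. (9.1) (transitivity on primes),
  (9.3) (`Z_𝔓 = 1 ⟺` totally split).
-/

noncomputable section

open scoped NumberField Pointwise IntermediateField
open NumberField

namespace Literature.NumberTheory.ComplexMultiplication

/-! ## §1. Dictionary: `Gal(L/ℚ)` acting on ideals of `𝔬_L` versus extension along `Aut(L)` -/

section Dictionary

variable {k L : Type*} [Field k] [Field L] [NumberField L]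

/-- Every ring automorphism of `L` is a `ℚ`-algebra automorphism: the coercion `Gal(L/ℚ) → Aut(L)` is onto.
[folklore] -/
private theorem exists_algEquiv_toRingEquiv_eq (g : L ≃+* L) : ∃ g' : L ≃ₐ[ℚ] L, (g' : L ≃+* L) = g :=
  ⟨AlgEquiv.ofRingEquiv (f := g) (fun x => by simp), by ext x; rfl⟩

/-- The pointwise action of `g ∈ Gal(L/ℚ)` on an ideal of `𝔬_L` is extension along `g` restricted to `𝔬_L`.
[folklore] -/
private theorem algEquiv_smul_eq_map (g : L ≃ₐ[ℚ] L) (I : Ideal (𝓞 L)) :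
    g • I = I.map (RingOfIntegers.mapRingHom (g : L ≃+* L).toRingHom) := by
  rw [Ideal.pointwise_smul_def]
  congr 1

/-- `(𝔞^σ𝔬_L)^g = 𝔞^{g ∘ σ}𝔬_L`: the Galois action on the extension of an ideal of `k` along `σ : k → L`.
[cite: Shimura1998, §8.3 Prop. 29 (proof), p. 63] -/
theorem map_mapRingHom_algEquiv_smul (g : L ≃ₐ[ℚ] L) (σ : k →+* L) (𝔞 : Ideal (𝓞 k)) :
    𝔞.map (RingOfIntegers.mapRingHom ((g : L ≃+* L) • σ)) = g • 𝔞.map (RingOfIntegers.mapRingHom σ) := by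
  rw [algEquiv_smul_eq_map, map_mapRingHom_smul]

/-- An automorphism fixing the element `x` fixes the ideal `(x)`. [folklore] -/
private theorem algEquiv_smul_span_singleton_eq {g : L ≃ₐ[ℚ] L} {x : 𝓞 L} (hx : g (x : L) = x) :
    g • (Ideal.span {x} : Ideal (𝓞 L)) = Ideal.span {x} := by
  rw [algEquiv_smul_eq_map, Ideal.map_span, Set.image_singleton]
  congr 2
  exact RingOfIntegers.ext hx

end Dictionary

/-! ## §2. Primes of `L` above a prime `v` of `k`: one `Gal(L/σL(k))`-orbit, free above a completely split `p` -/

section Orbit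

variable {k L : Type*} [Field k] [NumberField k] [Field L] [NumberField L]

/-- **The primes of `L` above `v` form one orbit under `Gal(L/σL(k))`** (Neukirch I (9.1); Mathlib's
transitivity `Ideal.exists_smul_eq_of_isGaloisGroup` over the intermediate field `σL(k) ⊆ L`): two primes of
`𝔬_L` containing `v^{σL}𝔬_L` are conjugate by an automorphism of `L` fixing `σL(k)` pointwise.
[cite: NeukirchANT1999, Ch. I §9 Prop. (9.1)] -/
theorem exists_algEquiv_smul_eq_of_map_le [IsGalois ℚ L] (σL : k →+* L)
    (v : IsDedekindDomain.HeightOneSpectrum (𝓞 k)) {𝔓 𝔔 : Ideal (𝓞 L)} [𝔓.IsPrime] [𝔔.IsPrime]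
    (h𝔓 : v.asIdeal.map (RingOfIntegers.mapRingHom σL) ≤ 𝔓)
    (h𝔔 : v.asIdeal.map (RingOfIntegers.mapRingHom σL) ≤ 𝔔) :
    ∃ t : L ≃ₐ[ℚ] L, (t : L ≃+* L) • σL = σL ∧ t • 𝔓 = 𝔔 := by
  classical
  -- the intermediate field `M = σL(k)` and the transport `𝔬_k ≃ 𝔬_M`
  set M : IntermediateField ℚ L := (σL.toRatAlgHom).fieldRange with hM
  let e : k ≃ₐ[ℚ] M := AlgEquiv.ofInjectiveField σL.toRatAlgHom
  let eO : 𝓞 k ≃+* 𝓞 M := RingOfIntegers.mapRingEquiv (e : k ≃+* M)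
  have hfac : RingOfIntegers.mapRingHom σL = (algebraMap (𝓞 M) (𝓞 L)).comp (eO : 𝓞 k →+* 𝓞 M) := by
    ext x
    rfl
  -- the prime `v'` of `𝔬_M` corresponding to `v`
  set v' : Ideal (𝓞 M) := v.asIdeal.map (eO : 𝓞 k →+* 𝓞 M) with hv'
  have hv'max : v'.IsMaximal := by
    rw [hv']
    exact Ideal.map_isMaximal_of_equiv eO (p := v.asIdeal)
  have hmap : v.asIdeal.map (RingOfIntegers.mapRingHom σL) = v'.map (algebraMap (𝓞 M) (𝓞 L)) := by
    rw [hv', Ideal.map_map, ← hfac]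
  have hunder : ∀ (Q : Ideal (𝓞 L)) [Q.IsPrime], v.asIdeal.map (RingOfIntegers.mapRingHom σL) ≤ Q →
      Q.LiesOver v' := by
    intro Q _ hQ
    rw [hmap, Ideal.map_le_iff_le_comap] at hQ
    exact ⟨(hv'max.eq_of_le (Ideal.comap_ne_top _ (Ideal.IsPrime.ne_top inferInstance)) hQ)⟩
  haveI := hunder 𝔓 h𝔓
  haveI := hunder 𝔔 h𝔔
  haveI := Literature.NumberTheory.NumberFields.isGaloisGroup_fixingSubgroup_ringOfIntegers M
  obtain ⟨t, ht⟩ := Ideal.exists_smul_eq_of_isGaloisGroup v' 𝔓 𝔔 M.fixingSubgroup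
  refine ⟨t.1, ?_, ht⟩
  ext c
  rw [ringEquiv_smul_apply]
  have hc : σL c ∈ M := ⟨c, rfl⟩
  exact (IntermediateField.mem_fixingSubgroup_iff _ _).1 t.2 _ hc

omit [NumberField k] [NumberField L] in
/-- A prime of `𝔬_L` containing `v^{σL}𝔬_L`, `v ∋ p`, lies over `(p) ⊂ ℤ`. [folklore] -/
private theorem liesOver_span_of_map_le (σL : k →+* L) {p : ℕ} (hp : p.Prime)
    (v : IsDedekindDomain.HeightOneSpectrum (𝓞 k)) (hv : ((p : ℕ) : 𝓞 k) ∈ v.asIdeal)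
    {𝔓 : Ideal (𝓞 L)} [𝔓.IsPrime] (h𝔓 : v.asIdeal.map (RingOfIntegers.mapRingHom σL) ≤ 𝔓) :
    𝔓.LiesOver (Ideal.span {(p : ℤ)}) := by
  haveI hmax : (Ideal.span {(p : ℤ)}).IsMaximal :=
    ((Ideal.span_singleton_prime (by exact_mod_cast hp.ne_zero)).mpr
      (Nat.prime_iff_prime_int.mp hp)).isMaximal
        (by rw [ne_eq, Ideal.span_singleton_eq_bot]; exact_mod_cast hp.ne_zero)
  refine ⟨(hmax.eq_of_le (Ideal.comap_ne_top _ (Ideal.IsPrime.ne_top inferInstance)) ?_)⟩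
  rw [Ideal.span_singleton_le_iff_mem, Ideal.mem_comap, map_natCast]
  have h1 : RingOfIntegers.mapRingHom σL ((p : ℕ) : 𝓞 k) ∈ 𝔓 := h𝔓 (Ideal.mem_map_of_mem _ hv)
  rwa [map_natCast] at h1

omit [NumberField k] in
/-- **Above a completely split `p` the primes are permuted freely**: an automorphism of `L` fixing a prime
`𝔓 ∋ p` with `p` completely split in `L` is the identity (the tree's `stabilizer_eq_bot_of_splitsCompletely`,
Neukirch I (9.3): `Z_𝔓 = 1`). [cite: NeukirchANT1999, Ch. I §9 Prop. (9.3)] -/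
theorem algEquiv_eq_one_of_smul_eq_of_splitsCompletely [IsGalois ℚ L] (σL : k →+* L) {p : ℕ} (hp : p.Prime)
    (hsplit : GaloisRepresentations.SplitsCompletely L p)
    (v : IsDedekindDomain.HeightOneSpectrum (𝓞 k)) (hv : ((p : ℕ) : 𝓞 k) ∈ v.asIdeal)
    {𝔓 : Ideal (𝓞 L)} [𝔓.IsPrime] (h𝔓 : v.asIdeal.map (RingOfIntegers.mapRingHom σL) ≤ 𝔓)
    {h : L ≃ₐ[ℚ] L} (hh : h • 𝔓 = 𝔓) : h = 1 := by
  haveI := liesOver_span_of_map_le σL hp v hv h𝔓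
  have hbot := Literature.NumberTheory.NumberFields.stabilizer_eq_bot_of_splitsCompletely hp hsplit
    (P := 𝔓) ⟨inferInstance, inferInstance⟩
  have hmem : h ∈ MulAction.stabilizer (L ≃ₐ[ℚ] L) 𝔓 := hh
  rw [hbot] at hmem
  exact hmem

/-- **«`g𝔓 ∣ v` forces `g ∈ Gal(L/σL(k))`»** above a completely split `p`: if `𝔓 ⊇ v^{σL}𝔬_L` and also
`h𝔓 ⊇ v^{σL}𝔬_L`, then `h` fixes `σL(k)` pointwise (`h𝔓 = t𝔓` for some `t ∈ Gal(L/σL(k))` by transitivity,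
and `t⁻¹h ∈ Z_𝔓 = 1`). [cite: NeukirchANT1999, Ch. I §9 Prop. (9.1), (9.3)] -/
theorem smul_ringHom_eq_of_map_le_smul [IsGalois ℚ L] (σL : k →+* L) {p : ℕ} (hp : p.Prime)
    (hsplit : GaloisRepresentations.SplitsCompletely L p)
    (v : IsDedekindDomain.HeightOneSpectrum (𝓞 k)) (hv : ((p : ℕ) : 𝓞 k) ∈ v.asIdeal)
    {𝔓 : Ideal (𝓞 L)} [𝔓.IsPrime] (h𝔓 : v.asIdeal.map (RingOfIntegers.mapRingHom σL) ≤ 𝔓)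
    {h : L ≃ₐ[ℚ] L} (hh : v.asIdeal.map (RingOfIntegers.mapRingHom σL) ≤ h • 𝔓) :
    (h : L ≃+* L) • σL = σL := by
  haveI : (h • 𝔓).IsPrime := Ideal.IsPrime.smul h
  obtain ⟨t, htσ, ht⟩ := exists_algEquiv_smul_eq_of_map_le σL v h𝔓 hh
  have h1 : (t⁻¹ * h) • 𝔓 = 𝔓 := by rw [mul_smul, ← ht, inv_smul_smul]
  have h2 : t⁻¹ * h = 1 := algEquiv_eq_one_of_smul_eq_of_splitsCompletely σL hp hsplit v hv h𝔓 h1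
  have h3 : h = t := by
    have := congrArg (t * ·) h2
    simpa using this
  rw [h3]
  exact htσ

end Orbit

/-! ## §3. `S*` read off the prime factorisation of the reflex type norm -/

section Factorisation

variable {K k L : Type*} [Field K] [NumberField K] [Field k] [NumberField k] [Field L] [NumberField L]

omit [NumberField K] in
/-- **[Shi98] §13.1 (7): `j(π)𝔬_L ⊆ g𝔓 ⟺ g ∈ S*_j`** — for `𝔓 ∣ v` a prime of `L` above a rational prime `p`
completely split in `L`, `k ⊇ K*` along `σL` (`Stab(σL) ≤ Stab(Φ)`), and `(π)` the reflex type norm of `v`: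
the primes of `L` dividing `j(π)` are exactly the `g𝔓`, `g ∈ S*_j = {g | g⁻¹ ∘ j ∈ Φ}`.  (⇐): the product
`∏_{σ ∈ Ψ_j} v^σ𝔬_L` lies in its factor `v^{gσL}𝔬_L = g(v^{σL}𝔬_L) ⊆ g𝔓`.  (⇒): a prime containing the
product contains a factor `v^{g'σL}𝔬_L`, `g' ∈ S*_j`; then `g'⁻¹g𝔓 ∣ v`, so `g'⁻¹g` fixes `σL(k)` (§2), hence
stabilises `Φ`, and `g = g'(g'⁻¹g) ∈ S*_j H* = S*_j`. [cite: Shimura1998, §13.1 (7), p. 97; §8.3 Prop. 28] -/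
theorem map_span_le_smul_iff_mem_reflexLift [IsGalois ℚ L] (Φ : Set (K →+* L)) (j : K →+* L)
    (σL : k →+* L) (hk : MulAction.stabilizer (L ≃+* L) σL ≤ MulAction.stabilizer (L ≃+* L) Φ)
    {p : ℕ} (hp : p.Prime) (hsplit : GaloisRepresentations.SplitsCompletely L p)
    (v : IsDedekindDomain.HeightOneSpectrum (𝓞 k)) (hv : ((p : ℕ) : 𝓞 k) ∈ v.asIdeal)
    {𝔓 : Ideal (𝓞 L)} [𝔓.IsPrime] (h𝔓 : v.asIdeal.map (RingOfIntegers.mapRingHom σL) ≤ 𝔓)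
    {π : 𝓞 K} (hπ : IsReflexTypeNorm Φ j σL v.asIdeal (Ideal.span {π})) (g : L ≃ₐ[ℚ] L) :
    (Ideal.span {π} : Ideal (𝓞 K)).map (RingOfIntegers.mapRingHom j) ≤ g • 𝔓 ↔
      (g : L ≃+* L) ∈ (reflexLift Φ j : Set (L ≃+* L)) := by
  classical
  rw [hπ]
  constructor
  · intro hle
    haveI : (g • 𝔓).IsPrime := Ideal.IsPrime.smul g
    rw [reflexNormIdeal_eq_prod, Ideal.IsPrime.prod_le inferInstance] at hle
    obtain ⟨σ, hσ, hσle⟩ := hle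
    rw [Set.Finite.mem_toFinset, mem_reflexTypeOn_iff] at hσ
    obtain ⟨g₀, hg₀, rfl⟩ := hσ
    obtain ⟨g', rfl⟩ := exists_algEquiv_toRingEquiv_eq g₀
    rw [map_mapRingHom_algEquiv_smul] at hσle
    -- `v^{σL}𝔬_L ≤ (g'⁻¹ g) 𝔓`
    have hle' : v.asIdeal.map (RingOfIntegers.mapRingHom σL) ≤ (g'⁻¹ * g) • 𝔓 := by
      rw [mul_smul, Ideal.subset_pointwise_smul_iff, inv_inv]
      exact hσle
    have hfix := smul_ringHom_eq_of_map_le_smul σL hp hsplit v hv h𝔓 hle'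
    have hstab : ((g'⁻¹ * g : L ≃ₐ[ℚ] L) : L ≃+* L) ∈ MulAction.stabilizer (L ≃+* L) Φ := hk hfix
    have hprod : (g : L ≃+* L) = (g' : L ≃+* L) * ((g'⁻¹ * g : L ≃ₐ[ℚ] L) : L ≃+* L) := by
      ext x
      simp
    rw [hprod, mul_mem_reflexLift_iff_of_mem_stabilizer Φ j hstab, mem_reflexLift]
    exact hg₀
  · intro hg
    have hσ : (g : L ≃+* L) • σL ∈ reflexTypeOn Φ j σL := smul_mem_reflexTypeOn σL hg
    refine (reflexNormIdeal_le_map_of_mem Φ j σL v.asIdeal hσ).trans ?_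
    rw [map_mapRingHom_algEquiv_smul, Ideal.pointwise_smul_le_pointwise_smul_iff]
    exact h𝔓

end Factorisation

/-! ## §4. The theorem: a primitive type forces `ℚ(π) = K` -/

section Main

variable {K k L : Type*} [Field K] [NumberField K] [Field k] [NumberField k] [Field L] [NumberField L]

/-- **PRIMITIVE TYPE ⇒ THE REFLEX TYPE NORM OF A TOTALLY SPLIT PRIME GENERATES `K`** ([Shi98] §8.2 Prop. 26
«`(F; {φᵢ})` is primitive iff `H₁ = H'`» combined with §13.1 (7) «`∏_{τ ∈ S*} 𝔓₁^τ ∼ g(N_{k/K*}𝔓)`»; the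
«`ℚ(π) = K`» step of the Shimura–Taniyama Frobenius for a CM structure of PRIMITIVE type, cf. §13.1 Thm. 1 (ii)
for `[K : ℚ] = 2`).  Let `L/ℚ` be a finite Galois extension receiving `K` by `j` and `k` by `σL`, with
`σL(k) ⊇ K*` in the form `Stab(σL) ≤ Stab(Φ)`; let `p` split completely in `L`, `v ∋ p` a prime of `k`, and
`π ∈ 𝔬_K` with `j(π)𝔬_L = ∏_{σ ∈ Ψ_j} v^σ𝔬_L` (`IsReflexTypeNorm`).  If `(Φ, j)` is primitive then
`ℚ(π) = K`.  Proof: every `u ∈ Gal(L/ℚ(jπ))` fixes `j(π)𝔬_L`, so `uS*_j = S*_j` by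
`map_span_le_smul_iff_mem_reflexLift`, so `u ∈ Stab(S*_j) = Gal(L/jK)` (`isPrimitive_iff`), whence
`jK ⊆ ℚ(jπ)`. [cite: Shimura1998, §8.2 Prop. 26, p. 61; §13.1 (7) and Thm. 1, pp. 97–98] -/
theorem adjoin_eq_top_of_isReflexTypeNorm_of_isPrimitive_of_splitsCompletely [IsGalois ℚ L]
    (Φ : Set (K →+* L)) (j : K →+* L) (σL : k →+* L) (hprim : IsPrimitive (L ≃+* L) Φ j)
    (hk : MulAction.stabilizer (L ≃+* L) σL ≤ MulAction.stabilizer (L ≃+* L) Φ)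
    {p : ℕ} (hp : p.Prime) (hsplit : GaloisRepresentations.SplitsCompletely L p)
    (v : IsDedekindDomain.HeightOneSpectrum (𝓞 k)) (hv : ((p : ℕ) : 𝓞 k) ∈ v.asIdeal)
    {π : 𝓞 K} (hπ : IsReflexTypeNorm Φ j σL v.asIdeal (Ideal.span {π})) :
    ℚ⟮(π : K)⟯ = ⊤ := by
  classical
  -- a prime `𝔓` of `L` above `v` (going up along `σL`)
  obtain ⟨𝔓, h𝔓prime, h𝔓⟩ : ∃ 𝔓 : Ideal (𝓞 L), 𝔓.IsPrime ∧
      v.asIdeal.map (RingOfIntegers.mapRingHom σL) ≤ 𝔓 := by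
    letI : Algebra k L := σL.toAlgebra
    have hσL : RingOfIntegers.mapRingHom σL = algebraMap (𝓞 k) (𝓞 L) := rfl
    haveI := v.isPrime
    obtain ⟨⟨𝔓, h𝔓prime, h𝔓over⟩⟩ := (inferInstance : Nonempty (Ideal.primesOver v.asIdeal (𝓞 L)))
    refine ⟨𝔓, h𝔓prime, ?_⟩
    rw [hσL, Ideal.map_le_iff_le_comap]
    exact h𝔓over.over.le
  haveI := h𝔓prime
  -- the ideal `I = j(π)𝔬_L` and its stabiliser
  set I : Ideal (𝓞 L) := (Ideal.span {π} : Ideal (𝓞 K)).map (RingOfIntegers.mapRingHom j) with hI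
  have hIspan : I = Ideal.span {RingOfIntegers.mapRingHom j π} := by
    rw [hI, Ideal.map_span, Set.image_singleton]
  -- Step 1: an automorphism fixing `j π` stabilises `S*_j`
  have hstab : ∀ u : L ≃ₐ[ℚ] L, u (j (π : K)) = j (π : K) →
      (u : L ≃+* L) ∈ MulAction.stabilizer (L ≃+* L) (reflexLift Φ j : Set (L ≃+* L)) := by
    intro u hu
    have huI : u • I = I := by
      rw [hIspan]
      exact algEquiv_smul_span_singleton_eq (by simpa using hu)
    have key : ∀ g : L ≃ₐ[ℚ] L, ((u * g : L ≃ₐ[ℚ] L) : L ≃+* L) ∈ (reflexLift Φ j : Set (L ≃+* L)) ↔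
        (g : L ≃+* L) ∈ (reflexLift Φ j : Set (L ≃+* L)) := by
      intro g
      rw [← map_span_le_smul_iff_mem_reflexLift Φ j σL hk hp hsplit v hv h𝔓 hπ g,
        ← map_span_le_smul_iff_mem_reflexLift Φ j σL hk hp hsplit v hv h𝔓 hπ (u * g), ← hI,
        mul_smul]
      nth_rw 1 [← huI]
      rw [Ideal.pointwise_smul_le_pointwise_smul_iff]
    rw [MulAction.mem_stabilizer_iff]
    ext x
    rw [Set.mem_smul_set_iff_inv_smul_mem]
    obtain ⟨x', rfl⟩ := exists_algEquiv_toRingEquiv_eq x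
    have h1 : ((u : L ≃ₐ[ℚ] L) : L ≃+* L)⁻¹ • (x' : L ≃+* L) = ((u⁻¹ * x' : L ≃ₐ[ℚ] L) : L ≃+* L) := by
      ext y; simp
    rw [h1, ← key (u⁻¹ * x'), ← mul_assoc, mul_inv_cancel, one_mul]
  -- Step 2: primitivity: such `u` fix `j`
  have hfix : ∀ u : L ≃ₐ[ℚ] L, u (j (π : K)) = j (π : K) → ∀ x : K, u (j x) = j x := by
    intro u hu x
    have h1 := (isPrimitive_iff Φ j).1 hprim (hstab u hu)
    rw [MulAction.mem_stabilizer_iff] at h1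
    exact RingHom.congr_fun h1 x
  -- Step 3: Galois correspondence: `j(K) ⊆ ℚ(j π)`
  set E : IntermediateField ℚ L := ℚ⟮j (π : K)⟯ with hE
  set F : IntermediateField ℚ L := (j.toRatAlgHom).fieldRange with hF
  have hFE : F ≤ E := by
    rw [← IsGalois.fixedField_fixingSubgroup E, IntermediateField.le_iff_le]
    intro u hu
    rw [IntermediateField.mem_fixingSubgroup_iff] at hu ⊢
    have huπ : u (j (π : K)) = j (π : K) := hu _ (IntermediateField.mem_adjoin_simple_self ℚ _)
    rintro _ ⟨x, rfl⟩
    exact hfix u huπ x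
  -- Step 4: pull back along `j`
  rw [eq_top_iff]
  intro x _
  have hx : j x ∈ E := hFE ⟨x, rfl⟩
  have hEmap : E = (ℚ⟮(π : K)⟯).map j.toRatAlgHom := by
    rw [hE, IntermediateField.adjoin_map, Set.image_singleton]
    rfl
  rw [hEmap, IntermediateField.mem_map] at hx
  obtain ⟨y, hy, hyx⟩ := hx
  have hxy : y = x := j.injective (by simpa using hyx)
  rwa [hxy] at hy

end Main

end Literature.NumberTheory.ComplexMultiplication

end
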